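import Literature.NumberTheory.EllipticCurves.CoatesLiTianZhai2015.HeegnerTraceRelation
import Literature.NumberTheory.EllipticCurves.CoatesLiTianZhai2015.QuadraticTwistsX049
import Literature.NumberTheory.EllipticCurves.Rank1Residual.HeightLValueMatch
import Literature.NumberTheory.EllipticCurves.LeadingTerm

/-!
# STUB-IDEAS k1 (gen 15) — `stub_heegnerIndexLowerAtTwo`: WEAKEN / STRENGTHEN

Typed sketch for the idea card `Ideas/stub-heegnerindexloweratwo-k1-g15.md` (crux item
`stmt-BirchSwinnertonDyer-27851`, decl `PrintCf2.SplitBadTwoLowerHalfOfFacts`, LOWER half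
`ord₂ Ш_an(W) ≤ ord₂ #Ш(W)` on the additive class `W = 49a1^{(d)}, 49a2^{(d)}`, `d ≢ 1 (mod 4)`).

Nothing here proves the stub, the crux, or BSD.  Contents:

* §1 REAL OBJECTS, PROVED: the WEAKEST SUFFICIENT FORM of an arm-M″ anchor — a member `W₀` with
  `ord₂ Ш_an(W₀) ≤ 0` ("parity anchor") already satisfies `MissingLowerBoundAt W₀ 2`, by the tree's
  `missingLowerBoundAt_of_shaPRankAtLeast` at `d = 0` and GZK finiteness (no descent, no Iwasawa theory).
* §2 REAL OBJECTS, SIGNATURES ONLY (`def … : Prop`, nothing asserted): the three helper lemmas of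
  PLAN 1 («parity anchors in all six keys from conductor-`8R` ring-class Heegner points of `X₀(49)` over
  ODD-discriminant fields `K = ℚ(√−ℓ₀)`»): (L1) the dyadic trace relation `ℓ ∣ n` at `ℓ = 2`
  (Darmon 2004 Prop. 3.10, third case) in the vocabulary of `HeegnerPointsOfConductor.lean`;
  (L2) the genus characters of 2-power conductor (`i ∈ K[4]`, `√2 ∈ K[8]`); (L3) the STRONGEST
  PROVABLE FORM this plan bets on — the parity family for key `(0,5)`: `Ш_an(49a1^{(−2ℓ₀)})` has
  `ord₂ ≤ 0` for every prime `ℓ₀ ≡ 3 (mod 8)` with `(ℓ₀/7) = −1` (first member `d₀ = −38`).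
* §3 ℤ-SHADOW, PROVED (`omega`): arm M″ consumes an anchor ONLY through `A₀ ≤ B₀`; with a parity
  anchor (`A₀ = 0`) the member inequality `A ≤ B` follows from the arm-M″ relations using `0 ≤ B₀`
  alone — i.e. NO `BSD₂(W₀)` is needed at the anchor.
-/

set_option linter.dupNamespace false

noncomputable section

open scoped Classical

open NumberField WeierstrassCurve
open Literature.NumberTheory.EllipticCurves
open Literature.NumberTheory.EllipticCurves.ModularForms
open Literature.NumberTheory.EllipticCurves.Rank1Residual
open Literature.NumberTheory.EllipticCurves.Rank1Residual.Typed

namespace Summit.BirchSwinnertonDyer.BirchSwinnertonDyer.Cruxes.SplitBadTwoLowerHalfOfFacts.StubIdeasK1G15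

/-! ## §1 Parity anchor ⟹ LOWER at the anchor (real objects, proved) -/

/-- **Weakest sufficient anchor.** If `Ш_an(W) = q ∈ ℚ` with `ord₂ q ≤ 0` and `r_an(W) ≤ 1`, then the
LOWER half `MissingLowerBoundAt W 2` holds — from GZK finiteness of `Ш` and the tree lemma
`missingLowerBoundAt_of_shaPRankAtLeast` at exponent `d = 0` (the trivial subgroup). -/
theorem missingLowerBoundAt_two_of_parityAnchor (W : WeierstrassCurve ℚ) [W.IsElliptic]
    (hGZK : rank_eq_analyticRank_of_analyticRank_le_one) (hr : W.analyticRank ≤ 1)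
    {q : ℚ} (hq : shaAn W = (q : ℂ)) (hv : padicValRat 2 q ≤ 0) :
    MissingLowerBoundAt W 2 := by
  haveI : Fact (Nat.Prime 2) := ⟨Nat.prime_two⟩
  have hfin : Finite W.sha := (hGZK W hr).2
  refine missingLowerBoundAt_of_shaPRankAtLeast (W := W) (p := 2) hfin hq (d := 0)
    (by exact_mod_cast hv) ?_
  refine ⟨⊥, bot_le, ?_, by simp⟩
  intro c hc
  rw [AddSubgroup.mem_bot] at hc
  simp [hc]

/-- The same, for an analytic-rank-ONE member of the class (the shape arm M″ wants its anchors in). -/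
theorem missingLowerBoundAt_two_of_parityAnchor_rankOne (W : WeierstrassCurve ℚ) [W.IsElliptic]
    (hGZK : rank_eq_analyticRank_of_analyticRank_le_one) (hr : W.analyticRank = 1)
    {q : ℚ} (hq : shaAn W = (q : ℂ)) (hv : padicValRat 2 q ≤ 0) :
    MissingLowerBoundAt W 2 :=
  missingLowerBoundAt_two_of_parityAnchor W hGZK hr.le hq hv

/-! ## §2 Helper-lemma signatures of PLAN 1 (real objects; `Prop`s, nothing asserted) -/

/-- **(L1) Dyadic trace relation, case `ℓ ∣ n` at `ℓ = 2`** (Darmon 2004, CBMS 101, Prop. 3.10, third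
case: `Trace_{H_{nℓ}/H_n} P_{nℓ} = a_ℓ P_n − P_{n/ℓ}` when `ℓ ∣ n`), under CLTZ's standing field
`K = ℚ(√−ℓ₀)` and in the vocabulary of `traceRelation_inert`: for `2 ∣ M`, `(2M, C) = 1`,
`Σ_{σ ∈ Gal(H_{2M}/H_M)} σ y = a₂ · f(P_M) − f(P_{M/2})` in `E(ℂ)`.  The levels used by PLAN 1 are
`M = 2R → 4R → 8R` on `X₀(49)` (`a₂(49a1) = 1`).  Stated on the nose for the compatible family
`(ℂ/𝒪_n → ℂ/𝔠_n⁻¹)`; Darmon's printed form is existential in the lower-level points (a Galois conjugate on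
the `P_{M/2}` term may be needed for print-verbatim typing).  Signature only. -/
def traceRelation_two_dvd : Prop :=
  ∀ (W : WeierstrassCurve ℚ) [W.IsElliptic] [W.IsGloballyMinimal] [NeZero (W.conductorNorm ℤ)]
    (K : Type) [Field K] [NumberField K] (_hK : IsImaginaryQuadratic K)
    (ℓ₀ : ℕ) (_hℓ₀ : ℓ₀.Prime) (_hℓ₀' : 3 < ℓ₀) (_hℓ₀'' : ℓ₀ % 4 = 3)
    (_hKℓ₀ : NumberField.discr K = -(ℓ₀ : ℤ))
    (_hH : SatisfiesHeegnerHypothesis (W.conductorNorm ℤ) K) (ι : K →+* ℂ)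
    (Dt : ModularParametrizationData W (W.conductorNorm ℤ)) (β : ℤ)
    (_hβ : (4 * (W.conductorNorm ℤ : ℤ)) ∣ β ^ 2 - NumberField.discr K)
    (M : ℕ) (_hM : M ≠ 0) (_h2M : 2 ∣ M) (_hMC : Nat.Coprime (2 * M) (W.conductorNorm ℤ))
    (y : (W.baseChange (ringClassField K ι (M * 2))).toAffine.Point),
    WeierstrassCurve.Affine.Point.map (ringClassField K ι (M * 2)).subtype.toRatAlgHom y =
        heegnerPointComplexOfConductor Dt (NumberField.discr K) β (M * 2) →
    ∑ᶠ σ ∈ (ringClassGalOver ι (M * 2) M : Set (ringClassField K ι (M * 2) ≃ₐ[ℚ]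
        ringClassField K ι (M * 2))),
        WeierstrassCurve.Affine.Point.map (ringClassField K ι (M * 2)).subtype.toRatAlgHom
          (pointGalHom W (ringClassField K ι (M * 2)) σ y) =
      (W.frobeniusTrace 2) • heegnerPointComplexOfConductor Dt (NumberField.discr K) β M -
        heegnerPointComplexOfConductor Dt (NumberField.discr K) β (M / 2)

/-- **(L2) Genus characters of 2-power conductor** (classical genus theory of the orders `𝒪₄`, `𝒪₈`
of `K = ℚ(√−ℓ₀)`, `ℓ₀ ≡ 3 (mod 4)`: the characters `χ₋₄ ∘ N`, `χ_{±8} ∘ N` are anticyclotomic of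
conductor `4`, `8`): `i ∈ K[4]` and `√2 ∈ K[8]` inside `ℂ`.  These cut out the quadratic ring-class
characters whose Heegner components land in the twists `A^{(−ℓ₀ m)}`, `m ∈ ⟨−1, 2, q*⟩`, i.e. in ALL
SIX keys of the additive class.  Signature only. -/
def genusElements_mem_ringClassField : Prop :=
  ∀ (K : Type) [Field K] [NumberField K] (_hK : IsImaginaryQuadratic K)
    (ℓ₀ : ℕ) (_hℓ₀ : ℓ₀.Prime) (_hℓ₀' : 3 < ℓ₀) (_hℓ₀'' : ℓ₀ % 4 = 3)
    (_hKℓ₀ : NumberField.discr K = -(ℓ₀ : ℤ)) (ι : K →+* ℂ),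
    Complex.I ∈ ringClassField K ι 4 ∧ ((Real.sqrt 2 : ℝ) : ℂ) ∈ ringClassField K ι 8

/-- **(L3) The parity family for key `(0,5)` — the STRONGEST PROVABLE FORM this plan bets on.**
For every prime `ℓ₀ ≡ 3 (mod 8)` with `(ℓ₀/7) = −1` (so `7` splits and `2` is inert in
`K = ℚ(√−ℓ₀)`, `h_K` odd, and `4 ∤ h(−8ℓ₀)` by Rédei), every globally minimal model `W` of
`49a1^{(−2ℓ₀)}` (key `(0,5)`: `d/2 = −ℓ₀ ≡ 5 (mod 8)`; root number `−1`) has `Ш_an(W) = q` with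
`ord₂ q ≤ 0`.  Mechanism: the conductor-`8` ring-class Heegner point `y_χ = Σ χ₈(σ) P₈^σ` on
`X₀(49) = A` satisfies `y_χ = 2 z + 4 y_K` with `z = Tr_{K[8]/K(√2)} P₈` (L1 + `traceRelation_inert`
at `p = 2`, `a₂ = 1`), its exact 2-divisibility in `A(K(√2))⁻` is decided by genus theory (L2, Birch's
`y_K + ȳ_K = h·[0]`, `h` odd), and CST14 Thm 1.1 (explicit Gross–Zagier with the ring-class character
`χ₈`, `c = 8`, `(c, 49) = 1`) converts it into `ord₂ Ш_an(W)` against the FIXED rank-0 partner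
`A^{(2)}`.  First member `ℓ₀ = 19`, `d₀ = −38` (the arm-M″ anchor of record for key `(0,5)`).
CONJECTURAL research statement (size S/M); nothing asserted. -/
def parityFamily_key05 : Prop :=
  ∀ (ℓ₀ : ℕ), ℓ₀.Prime → ℓ₀ % 8 = 3 → legendreSym 7 (ℓ₀ : ℤ) = -1 →
    ∀ (W : WeierstrassCurve ℚ) [W.IsElliptic] [W.IsGloballyMinimal],
      (∃ C : VariableChange ℚ, C • W = cm7.quadraticTwist (-(2 * (ℓ₀ : ℚ)))) →
        ∃ q : ℚ, shaAn W = (q : ℂ) ∧ padicValRat 2 q ≤ 0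

/-- (L3 ⟹ LOWER on the family, real objects, proved modulo the two named inputs.) -/
theorem missingLowerBoundAt_two_of_parityFamily_key05 (hfam : parityFamily_key05)
    (hGZK : rank_eq_analyticRank_of_analyticRank_le_one)
    (ℓ₀ : ℕ) (hℓ₀ : ℓ₀.Prime) (h8 : ℓ₀ % 8 = 3) (h7 : legendreSym 7 (ℓ₀ : ℤ) = -1)
    (W : WeierstrassCurve ℚ) [W.IsElliptic] [W.IsGloballyMinimal]
    (hW : ∃ C : VariableChange ℚ, C • W = cm7.quadraticTwist (-(2 * (ℓ₀ : ℚ))))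
    (hr : W.analyticRank ≤ 1) : MissingLowerBoundAt W 2 := by
  obtain ⟨q, hq, hv⟩ := hfam ℓ₀ hℓ₀ h8 h7 W hW
  exact missingLowerBoundAt_two_of_parityAnchor W hGZK hr hq hv

/-! ## §3 ℤ-shadow of arm M″ with a PARITY anchor (proved): no `BSD₂(W₀)` is consumed -/

/-- **Arm M″ with a parity anchor.**  Integers: member `W` — `m` (2-adic valuation of the T1-side
value), `A = ord₂ Ш_an(W)`, `B = ord₂ #Ш(W)[2^∞]`, `g` (Tamagawa/torsion exponent), `n'` (restricted
Selmer length); anchor `W₀` — the same with subscript `0`; key constants `eA` (S2′), `eM` (ES/member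
comparison), `eC` (S3 control).  Relations: S2′ at member and anchor, S3 at member and anchor, the
member direction `m ≤ 2 n' + eM` (T1 + ERL), the anchor direction `2 n₀' + eM ≤ m₀` (Heegner-side,
printed at the anchor), and ONLY `A₀ = 0 ∧ 0 ≤ B₀` at the anchor.  Conclusion: `A ≤ B`. -/
theorem lower_of_armM_parityAnchor
    (m m₀ A A₀ B B₀ g g₀ n' n₀' eA eM eC : ℤ)
    (hS2 : m = 2 * A + 2 * g + eA) (hS2₀ : m₀ = 2 * A₀ + 2 * g₀ + eA)
    (hS3 : n' = B + g + eC) (hS3₀ : n₀' = B₀ + g₀ + eC)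
    (hMem : m ≤ 2 * n' + eM) (hAnc : 2 * n₀' + eM ≤ m₀)
    (hpar : A₀ = 0) (hB₀ : 0 ≤ B₀) : A ≤ B := by
  omega

/-- The anchor's own LOWER is free under parity (`A₀ = 0 ≤ B₀`): the shadow of §1. -/
theorem anchor_lower_of_parity (A₀ B₀ : ℤ) (hpar : A₀ = 0) (hB₀ : 0 ≤ B₀) : A₀ ≤ B₀ := by
  omega

/-- **What a NON-parity anchor would cost** (contrast): with `A₀ = a > 0` the same relations give only
`A ≤ B + (a − B₀)`, i.e. the anchor's own defect `a − B₀` — exactly `BSD₂`-LOWER at `W₀` — is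
imported into every member of the key.  (So R92″-by-computation must certify `A₀ ≤ B₀`, while a
parity anchor certifies it by `0 ≤ B₀`.) -/
theorem lower_defect_of_armM_generalAnchor
    (m m₀ A A₀ B B₀ g g₀ n' n₀' eA eM eC : ℤ)
    (hS2 : m = 2 * A + 2 * g + eA) (hS2₀ : m₀ = 2 * A₀ + 2 * g₀ + eA)
    (hS3 : n' = B + g + eC) (hS3₀ : n₀' = B₀ + g₀ + eC)
    (hMem : m ≤ 2 * n' + eM) (hAnc : 2 * n₀' + eM ≤ m₀) : A ≤ B + (A₀ - B₀) := by
  omega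

end Summit.BirchSwinnertonDyer.BirchSwinnertonDyer.Cruxes.SplitBadTwoLowerHalfOfFacts.StubIdeasK1G15

end
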